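import Literature.Geometry.Lorentzian.GlobalHyperbolicityStrongCausalityProofs
import Literature.Geometry.Lorentzian.CauchyHypersurfaceOpensIntersection
import Literature.Geometry.Lorentzian.RedShiftedHorizon
import HarnessLib

/-!
# Causal futures are connected; the event horizon of a region is nonempty when it separates

Two point-set facts of causal theory used to certify that an event horizon is NONEMPTY (so that,
e.g., horizon generator paths exist, `EventHorizonGenerators.lean`):

* `LorentzianMetric.isPreconnected_causalFuture_singleton` / `…_causalFuture` — `J⁺(p)` is preconnected
  (every point is joined to `p` by the image of a causal curve, a connected set), and `J⁺(S)` is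
  preconnected for preconnected `S` (O'Neill 1983, Ch. 14, p. 402: `J⁺(S) = ⋃_{p ∈ S} J⁺(p)`, each member
  meeting `S`).
* `CauchyDevelopment.nonempty_eventHorizonOf` — for a Cauchy development `𝒟` (connected data manifold)
  and any region `U`: if the causal future of the data `J⁺(ι X)` contains both a point of `I⁻(U)` and a
  point outside `I⁻(U)` (a "black-hole point" relative to `U`), then the event horizon
  `𝒟.eventHorizonOf U = ∂I⁻(U) ∩ J⁺(ι X)` is nonempty — the connected set `J⁺(ι X)` cannot be covered by
  the disjoint open sets `I⁻(U)` and `(closure I⁻(U))ᶜ` (Hawking–Ellis 1973, §9.2: the event horizon is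
  the boundary in `J⁺(𝒮)` of the region visible from infinity).

Everything is proved; no definitions, no named facts.

## References

* B. O'Neill, *Semi-Riemannian geometry*, Academic Press 1983, Ch. 14, pp. 402–403. [ONeillSemiRiemannian1983]
* S. W. Hawking, G. F. R. Ellis, *The large scale structure of space-time*, CUP 1973, §9.2. [HawkingEllis1973CUP]
-/

noncomputable section

open Set Filter Function
open scoped Manifold ContDiff Topology

namespace Literature.Geometry.Lorentzian

universe u

section General

variable {E : Type*} [NormedAddCommGroup E] [NormedSpace ℝ E] {H : Type*} [TopologicalSpace H]
  {I : ModelWithCorners ℝ E H} {n : ℕ∞ω} {M : Type*} [TopologicalSpace M] [ChartedSpace H M]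
  [IsManifold I ∞ M] {g : LorentzianMetric I n M} {τ : TimeOrientation g}

namespace LorentzianMetric

/-- **`J⁺(p)` is preconnected**: every `y ∈ J⁺(p)` lies, together with `p`, on the image `γ([a, b])` of a
future causal curve from `p` — a connected subset of `J⁺(p)`. O'Neill 1983, Ch. 14, p. 402.
[cite: ONeillSemiRiemannian1983, Ch. 14, pp. 402–403] -/
theorem isPreconnected_causalFuture_singleton (p : M) : IsPreconnected (g.causalFuture τ {p}) := by
  refine isPreconnected_of_forall p fun y hy ↦ ?_
  rcases hy with hy | ⟨p', hp', γ, a, b, hab, hγ, hγa, hγb⟩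
  · rw [mem_singleton_iff] at hy
    subst hy
    exact ⟨{y}, singleton_subset_iff.2 (subset_causalFuture g τ _ (mem_singleton _)), mem_singleton _,
      mem_singleton _, isPreconnected_singleton⟩
  · rw [mem_singleton_iff] at hp'
    subst hp'
    have hcont : ContinuousOn γ (Icc a b) := fun t ht ↦ (hγ.continuousAt ht).continuousWithinAt
    refine ⟨γ '' Icc a b, ?_, ⟨a, left_mem_Icc.2 hab.le, hγa⟩, ⟨b, right_mem_Icc.2 hab.le, hγb⟩,
      isPreconnected_Icc.image γ hcont⟩
    rintro _ ⟨t, ht, rfl⟩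
    rw [← hγa]
    exact hγ.apply_mem_causalFuture_apply_left ht

/-- **`J⁺(S)` is preconnected for preconnected `S`**: `J⁺(S) = ⋃_{p ∈ S} J⁺(p)` with every `J⁺(p)`
preconnected and meeting `S` at `p`. O'Neill 1983, Ch. 14, p. 402. [cite: ONeillSemiRiemannian1983, Ch. 14, pp. 402–403] -/
theorem isPreconnected_causalFuture {S : Set M} (hS : IsPreconnected S) :
    IsPreconnected (g.causalFuture τ S) := by
  refine isPreconnected_of_forall_pair fun x hx y hy ↦ ?_
  rw [causalFuture_eq_biUnion] at hx hy
  simp only [mem_iUnion, exists_prop] at hx hy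
  obtain ⟨p, hp, hxp⟩ := hx
  obtain ⟨q, hq, hyq⟩ := hy
  have hSsub : S ⊆ g.causalFuture τ S := subset_causalFuture g τ S
  have hpsub : g.causalFuture τ {p} ⊆ g.causalFuture τ S := causalFuture_mono (singleton_subset_iff.2 hp)
  have hqsub : g.causalFuture τ {q} ⊆ g.causalFuture τ S := causalFuture_mono (singleton_subset_iff.2 hq)
  have h1 : IsPreconnected (g.causalFuture τ {p} ∪ S) :=
    (isPreconnected_causalFuture_singleton p).union p (subset_causalFuture g τ _ (mem_singleton p)) hp hS
  have h2 : IsPreconnected (g.causalFuture τ {p} ∪ S ∪ g.causalFuture τ {q}) :=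
    h1.union q (Or.inr hq) (subset_causalFuture g τ _ (mem_singleton q))
      (isPreconnected_causalFuture_singleton q)
  exact ⟨_, union_subset (union_subset hpsub hSsub) hqsub, Or.inl (Or.inl hxp), Or.inr hyq, h2⟩

end LorentzianMetric

end General

/-! ### Cauchy developments -/

namespace CauchyDevelopment

variable {n : ℕ} {X : Type u} [TopologicalSpace X] [ChartedSpace (EuclideanSpace ℝ (Fin n)) X]
  [IsManifold (𝓡 n) ∞ X] [ConnectedSpace X] {D : InitialDataSet (𝓡 n) X}

/-- **The causal future of the data of a Cauchy development is preconnected** (the data manifold is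
connected, `isConnected_range_embed`). [cite: ONeillSemiRiemannian1983, Ch. 14, pp. 402–403] -/
theorem isPreconnected_causalFuture_range_embed (𝒟 : CauchyDevelopment D) :
    IsPreconnected (𝒟.metric.causalFuture 𝒟.timeOrientation (range 𝒟.embed)) :=
  LorentzianMetric.isPreconnected_causalFuture 𝒟.isConnected_range_embed.isPreconnected

/-- **The event horizon of a region is nonempty when it separates the future of the data**: if
`J⁺(ι X)` contains a point of `I⁻(U)` and a point not in `I⁻(U)`, then
`𝒟.eventHorizonOf U = ∂I⁻(U) ∩ J⁺(ι X) ≠ ∅`. Otherwise the preconnected set `J⁺(ι X)` would be covered by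
the disjoint open sets `I⁻(U)` and `(closure I⁻(U))ᶜ`, meeting both. Hawking–Ellis 1973, §9.2.
[cite: HawkingEllis1973CUP, §9.2 (p. 312)] -/
theorem nonempty_eventHorizonOf (𝒟 : CauchyDevelopment D) {U : Set 𝒟.carrier}
    (h₁ : (𝒟.metric.causalFuture 𝒟.timeOrientation (range 𝒟.embed) ∩
      𝒟.metric.chronologicalPast 𝒟.timeOrientation U).Nonempty)
    (h₂ : (𝒟.metric.causalFuture 𝒟.timeOrientation (range 𝒟.embed) \
      𝒟.metric.chronologicalPast 𝒟.timeOrientation U).Nonempty) :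
    (𝒟.eventHorizonOf U).Nonempty := by
  by_contra hempty
  rw [not_nonempty_iff_eq_empty] at hempty
  set C := 𝒟.metric.causalFuture 𝒟.timeOrientation (range 𝒟.embed) with hC_def
  set W := 𝒟.metric.chronologicalPast 𝒟.timeOrientation U with hW_def
  have hWopen : IsOpen W := LorentzianMetric.isOpen_chronologicalPast_of_boundaryless _ _ U
  have hconn : IsPreconnected C := 𝒟.isPreconnected_causalFuture_range_embed
  -- no point of `C` lies on the frontier of `W`
  have hfr : ∀ x ∈ C, x ∉ frontier W := fun x hxC hxfr ↦ by
    have : x ∈ 𝒟.eventHorizonOf U := ⟨hxfr, hxC⟩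
    rw [hempty] at this
    exact this
  -- `C ⊆ W ∪ (closure W)ᶜ`
  have hcover : C ⊆ W ∪ (closure W)ᶜ := fun x hxC ↦ by
    by_cases hx : x ∈ closure W
    · left
      by_contra hxW
      exact hfr x hxC ⟨hx, by rwa [hWopen.interior_eq]⟩
    · exact Or.inr hx
  obtain ⟨b, hbC, hbW⟩ := h₂
  have hbcl : b ∉ closure W := fun hb ↦ hfr b hbC ⟨hb, by rwa [hWopen.interior_eq]⟩
  obtain ⟨x, -, hxW, hxcl⟩ := hconn W (closure W)ᶜ hWopen isClosed_closure.isOpen_compl hcover h₁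
    ⟨b, hbC, hbcl⟩
  exact hxcl (subset_closure hxW)

end CauchyDevelopment

end Literature.Geometry.Lorentzian

end
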